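import Summits.AnomalousDissipation.AnomalousDissipation.Theorems.MarginalStabilityChainBurgersLayerKHStubStrainedA

/-!
# Line `Sketch`, stub `stub_strained` (lead) — part B: `poly × exp × Gaussian` bounds and the kernel
# of the Volterra–resolvent operator

Uniform integral / limit bounds for the class `‖f t‖ ≤ M (1+|t|)^n e^{at} e^{-t²/4}`
(`poly_exp_gauss_le`, `peg_integral_bound`, `peg_setIntegral_bound`, `tendsto_zero_of_peg(')`), and the
derivatives and size bounds of the pieces `A = k_α(t-y)e^{αt}`, `B = A'`, `r = (λ+iU)⁻¹`, `r₁ = r'`, `r₂ = r₁'`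
of the kernel `φ = A·r` (`hasDerivAt_kerA/B/R/R₁`, `kerR_bounds`), used by the integration by parts of part C.
-/

set_option linter.dupNamespace false

noncomputable section

open Complex MeasureTheory Filter Topology Set Metric intervalIntegral

namespace Summit.AnomalousDissipation.AnomalousDissipation.Theorems.BurgersLayerKH.Sheet.Strained

/-! ## §D Polynomial × exponential × Gaussian bounds -/

/-- `(1+|t|)^n e^{a t} e^{-t²/4} ≤ C e^{-t²/8}` with `C = n!·e·e^{2(1+|a|)²}`. [folklore] -/
theorem poly_exp_gauss_le (n : ℕ) (a : ℝ) : ∃ C : ℝ, 0 < C ∧ ∀ t : ℝ,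
    (1 + |t|) ^ n * Real.exp (a * t) * Real.exp (-(t ^ 2) / 4) ≤ C * Real.exp (-(t ^ 2) / 8) := by
  refine ⟨(n.factorial : ℝ) * Real.exp 1 * Real.exp (2 * (1 + |a|) ^ 2), by positivity, fun t => ?_⟩
  have ht : 0 ≤ |t| := abs_nonneg t
  -- (1+|t|)^n ≤ n! e^{1+|t|}
  have h1 : (1 + |t|) ^ n ≤ (n.factorial : ℝ) * Real.exp (1 + |t|) := by
    have := Real.pow_div_factorial_le_exp (x := 1 + |t|) (by positivity) n
    rw [div_le_iff₀ (by positivity : (0:ℝ) < n.factorial)] at this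
    linarith
  -- e^{a t} ≤ e^{|a| |t|}
  have h2 : Real.exp (a * t) ≤ Real.exp (|a| * |t|) := by
    rw [Real.exp_le_exp, ← abs_mul]; exact le_abs_self _
  -- completing the square
  have h3 : (1 + |a|) * |t| - t ^ 2 / 4 ≤ -(t ^ 2) / 8 + 2 * (1 + |a|) ^ 2 := by
    nlinarith [sq_nonneg (|t| - 4 * (1 + |a|)), sq_abs t]
  calc (1 + |t|) ^ n * Real.exp (a * t) * Real.exp (-(t ^ 2) / 4)
      ≤ ((n.factorial : ℝ) * Real.exp (1 + |t|)) * Real.exp (|a| * |t|) * Real.exp (-(t ^ 2) / 4) := by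
        gcongr
    _ = (n.factorial : ℝ) * Real.exp 1 * Real.exp ((1 + |a|) * |t| - t ^ 2 / 4) := by
        have : (1 + |a|) * |t| - t ^ 2 / 4 = |t| + |a| * |t| + -(t ^ 2) / 4 := by ring
        rw [this, Real.exp_add, Real.exp_add, Real.exp_add]; ring
    _ ≤ (n.factorial : ℝ) * Real.exp 1 * Real.exp (-(t ^ 2) / 8 + 2 * (1 + |a|) ^ 2) := by
        gcongr
    _ = (n.factorial : ℝ) * Real.exp 1 * Real.exp (2 * (1 + |a|) ^ 2) * Real.exp (-(t ^ 2) / 8) := by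
        rw [Real.exp_add]; ring

/-- `e^{-t²/8}` is integrable. [folklore] -/
theorem integrable_exp_neg_sq_div_eight : Integrable fun t : ℝ => Real.exp (-(t ^ 2) / 8) := by
  have := integrable_exp_neg_mul_sq (b := 1 / 8) (by norm_num)
  refine this.congr (Filter.Eventually.of_forall fun t => ?_)
  simp only; congr 1; ring

/-- `∫ e^{-t²/8} > 0`. [folklore] -/
theorem integral_exp_neg_sq_div_eight_pos : 0 < ∫ t : ℝ, Real.exp (-(t ^ 2) / 8) := by
  have h := integral_gaussian (1 / 8)
  have e : (fun x : ℝ => Real.exp (-(1 / 8) * x ^ 2)) = fun t => Real.exp (-(t ^ 2) / 8) := by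
    funext t; congr 1; ring
  rw [e] at h
  rw [h]; positivity

/-- **Uniform integral bound for the `poly × exp × Gaussian` class**: there is `C = C(n, a)` such that
every continuous `f` with `‖f t‖ ≤ M (1+|t|)^n e^{at} e^{-t²/4}` is integrable with `∫‖f‖ ≤ |M| C`.
[folklore] -/
theorem peg_integral_bound (n : ℕ) (a : ℝ) : ∃ C : ℝ, 0 < C ∧ ∀ f : ℝ → ℂ, Continuous f → ∀ M : ℝ,
    (∀ t, ‖f t‖ ≤ M * ((1 + |t|) ^ n * Real.exp (a * t) * Real.exp (-(t ^ 2) / 4))) →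
    Integrable f ∧ (∫ t, ‖f t‖) ≤ |M| * C := by
  obtain ⟨C₁, hC₁, hCb⟩ := poly_exp_gauss_le n a
  set K : ℝ := ∫ t : ℝ, Real.exp (-(t ^ 2) / 8) with hK
  have hKpos : 0 < K := integral_exp_neg_sq_div_eight_pos
  refine ⟨C₁ * K, by positivity, fun f hf M hb => ?_⟩
  have hbound : ∀ t, ‖f t‖ ≤ |M| * C₁ * Real.exp (-(t ^ 2) / 8) := by
    intro t
    calc ‖f t‖ ≤ M * ((1 + |t|) ^ n * Real.exp (a * t) * Real.exp (-(t ^ 2) / 4)) := hb t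
      _ ≤ |M| * ((1 + |t|) ^ n * Real.exp (a * t) * Real.exp (-(t ^ 2) / 4)) :=
          mul_le_mul_of_nonneg_right (le_abs_self M) (by positivity)
      _ ≤ |M| * (C₁ * Real.exp (-(t ^ 2) / 8)) := mul_le_mul_of_nonneg_left (hCb t) (abs_nonneg M)
      _ = |M| * C₁ * Real.exp (-(t ^ 2) / 8) := by ring
  have hdom : Integrable fun t => |M| * C₁ * Real.exp (-(t ^ 2) / 8) :=
    integrable_exp_neg_sq_div_eight.const_mul _
  have hint : Integrable f :=
    Integrable.mono' hdom hf.aestronglyMeasurable (Filter.Eventually.of_forall hbound)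
  refine ⟨hint, ?_⟩
  calc (∫ t, ‖f t‖) ≤ ∫ t, |M| * C₁ * Real.exp (-(t ^ 2) / 8) :=
        integral_mono hint.norm hdom hbound
    _ = |M| * (C₁ * K) := by rw [MeasureTheory.integral_const_mul, hK]; ring

/-- A function with a `poly × exp × Gaussian` bound tends to `0` at `+∞`. [folklore] -/
theorem tendsto_zero_of_peg {f : ℝ → ℂ} {M : ℝ} {n : ℕ} {a : ℝ}
    (hb : ∀ t, ‖f t‖ ≤ M * ((1 + |t|) ^ n * Real.exp (a * t) * Real.exp (-(t ^ 2) / 4))) :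
    Tendsto f atTop (𝓝 0) := by
  obtain ⟨C₁, hC₁, hCb⟩ := poly_exp_gauss_le n a
  have hbound : ∀ t, ‖f t‖ ≤ |M| * C₁ * Real.exp (-(t ^ 2) / 8) := by
    intro t
    calc ‖f t‖ ≤ M * ((1 + |t|) ^ n * Real.exp (a * t) * Real.exp (-(t ^ 2) / 4)) := hb t
      _ ≤ |M| * ((1 + |t|) ^ n * Real.exp (a * t) * Real.exp (-(t ^ 2) / 4)) :=
          mul_le_mul_of_nonneg_right (le_abs_self M) (by positivity)
      _ ≤ |M| * (C₁ * Real.exp (-(t ^ 2) / 8)) := mul_le_mul_of_nonneg_left (hCb t) (abs_nonneg M)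
      _ = |M| * C₁ * Real.exp (-(t ^ 2) / 8) := by ring
  have hg : Tendsto (fun t : ℝ => |M| * C₁ * Real.exp (-(t ^ 2) / 8)) atTop (𝓝 0) := by
    have h1 : Tendsto (fun t : ℝ => -(t ^ 2) / 8) atTop atBot := by
      have : Tendsto (fun t : ℝ => t ^ 2) atTop atTop := tendsto_pow_atTop two_ne_zero
      have h2 : Tendsto (fun t : ℝ => t ^ 2 / 8) atTop atTop := this.atTop_div_const (by norm_num)
      have h3 := tendsto_neg_atTop_atBot.comp h2
      refine h3.congr fun t => ?_
      simp only [Function.comp_apply]; ring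
    have := (Real.tendsto_exp_atBot.comp h1).const_mul (|M| * C₁)
    simpa using this
  exact squeeze_zero_norm hbound hg

/-- Eventual version of `tendsto_zero_of_peg`. [folklore] -/
theorem tendsto_zero_of_peg' {f : ℝ → ℂ} {M : ℝ} {n : ℕ} {a y : ℝ}
    (hb : ∀ t, y ≤ t → ‖f t‖ ≤ M * ((1 + |t|) ^ n * Real.exp (a * t) * Real.exp (-(t ^ 2) / 4))) :
    Tendsto f atTop (𝓝 0) := by
  set g : ℝ → ℂ := fun t => if y ≤ t then f t else 0 with hg
  have hgb : ∀ t, ‖g t‖ ≤ |M| * ((1 + |t|) ^ n * Real.exp (a * t) * Real.exp (-(t ^ 2) / 4)) := by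
    intro t
    by_cases ht : y ≤ t
    · simp only [hg, if_pos ht]
      exact (hb t ht).trans (mul_le_mul_of_nonneg_right (le_abs_self M) (by positivity))
    · simp only [hg, if_neg ht, norm_zero]; positivity
  have h1 : Tendsto g atTop (𝓝 0) := tendsto_zero_of_peg hgb
  refine h1.congr' ?_
  filter_upwards [eventually_ge_atTop y] with t ht
  simp only [hg, if_pos ht]

/-! ## §E The kernel of the Volterra–resolvent operator and the integration by parts -/

/-- The explicit (`α ≠ 0`) form of the Volterra kernel. [folklore] -/
theorem volterraKernel_of_ne {α : ℝ} (hα : α ≠ 0) (u : ℝ) :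
    volterraKernel α u = (1 - Real.exp (-(2 * α * u))) / (2 * α) := by
  simp [volterraKernel, hα]

/-- `0 ≤ k_α(u) ≤ 1/(2α)` for `u ≥ 0`, `α > 0`. [folklore] -/
theorem volterraKernel_bounds {α : ℝ} (hα : 0 < α) {u : ℝ} (hu : 0 ≤ u) :
    0 ≤ volterraKernel α u ∧ volterraKernel α u ≤ 1 / (2 * α) := by
  rw [volterraKernel_of_ne hα.ne']
  have h1 : Real.exp (-(2 * α * u)) ≤ 1 := by
    rw [Real.exp_le_one_iff]; nlinarith
  have h2 : 0 < Real.exp (-(2 * α * u)) := Real.exp_pos _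
  constructor
  · apply div_nonneg (by linarith) (by linarith)
  · apply div_le_div_of_nonneg_right _ (by linarith); linarith

/-- `k_α(0) = 0`. [folklore] -/
theorem volterraKernel_zero {α : ℝ} (hα : α ≠ 0) : volterraKernel α 0 = 0 := by
  rw [volterraKernel_of_ne hα]; simp

/-- `d/dt (-(2α(t-y))) = -2α`. [folklore] -/
theorem hasDerivAt_negLin (α y t : ℝ) : HasDerivAt (fun t => -(2 * α * (t - y))) (-(2 * α)) t := by
  have h : HasDerivAt (fun t => (-(2 * α)) * (t - y)) ((-(2 * α)) * 1) t :=
    ((hasDerivAt_id' t).sub_const y).const_mul (-(2 * α))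
  have e : (fun t => -(2 * α * (t - y))) = fun t => (-(2 * α)) * (t - y) := by funext s; ring
  have e2 : (-(2 * α)) * 1 = -(2 * α) := by ring
  rw [e2] at h
  rw [e]
  exact h

/-- `d/dt e^{αt} = α e^{αt}`. [folklore] -/
theorem hasDerivAt_expLin (α t : ℝ) : HasDerivAt (fun t => Real.exp (α * t)) (Real.exp (α * t) * α) t := by
  have h : HasDerivAt (fun t => α * t) (α * 1) t := (hasDerivAt_id' t).const_mul α
  rw [show Real.exp (α * t) * α = Real.exp (α * t) * (α * 1) by ring]
  exact h.exp

/-- **`A' = B`**: the derivative of `A(t) = k_α(t-y) e^{αt}` is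
`B(t) = e^{-2α(t-y)} e^{αt} + α k_α(t-y) e^{αt}`. [folklore] -/
theorem hasDerivAt_kerA {α : ℝ} (hα : α ≠ 0) (y t : ℝ) :
    HasDerivAt (fun t => volterraKernel α (t - y) * Real.exp (α * t))
      (Real.exp (-(2 * α * (t - y))) * Real.exp (α * t) +
        α * volterraKernel α (t - y) * Real.exp (α * t)) t := by
  have hk : HasDerivAt (fun t => volterraKernel α (t - y)) (Real.exp (-(2 * α * (t - y)))) t := by
    have hfun : (fun t => volterraKernel α (t - y)) = fun t => (1 - Real.exp (-(2 * α * (t - y)))) / (2 * α) := by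
      funext t; rw [volterraKernel_of_ne hα]
    rw [hfun]
    have h2 := ((hasDerivAt_negLin α y t).exp.const_sub 1).div_const (2 * α)
    refine h2.congr_deriv ?_
    field_simp
  have hE : HasDerivAt (fun t => Real.exp (α * t)) (Real.exp (α * t) * α) t := hasDerivAt_expLin α t
  exact (hk.mul hE).congr_deriv (by ring)

/-- **`B' = α² A`**. [folklore] -/
theorem hasDerivAt_kerB {α : ℝ} (hα : α ≠ 0) (y t : ℝ) :
    HasDerivAt (fun t => Real.exp (-(2 * α * (t - y))) * Real.exp (α * t) +
        α * volterraKernel α (t - y) * Real.exp (α * t))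
      (α ^ 2 * (volterraKernel α (t - y) * Real.exp (α * t))) t := by
  have hq : HasDerivAt (fun t => Real.exp (-(2 * α * (t - y)))) (Real.exp (-(2 * α * (t - y))) * (-(2 * α))) t :=
    (hasDerivAt_negLin α y t).exp
  have hE : HasDerivAt (fun t => Real.exp (α * t)) (Real.exp (α * t) * α) t := hasDerivAt_expLin α t
  have hA := hasDerivAt_kerA hα y t
  have h := (hq.mul hE).add (hA.const_mul α)
  have hfun : (fun t => Real.exp (-(2 * α * (t - y))) * Real.exp (α * t) +
      α * volterraKernel α (t - y) * Real.exp (α * t)) =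
      fun t => Real.exp (-(2 * α * (t - y))) * Real.exp (α * t) +
        α * (volterraKernel α (t - y) * Real.exp (α * t)) := by
    funext s; ring
  rw [hfun]
  exact h.congr_deriv (by ring)

/-- `d/dt e^{-t²/2} = -t e^{-t²/2}`. [folklore] -/
theorem hasDerivAt_gauss (t : ℝ) : HasDerivAt (fun t : ℝ => Real.exp (-(t ^ 2) / 2)) (Real.exp (-(t ^ 2) / 2) * (-t)) t := by
  have h : HasDerivAt (fun t : ℝ => (-(1 / 2)) * t ^ 2) ((-(1 / 2)) * (↑2 * t ^ (2 - 1))) t :=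
    (hasDerivAt_pow 2 t).const_mul (-(1 / 2))
  have e : (fun t : ℝ => Real.exp (-(t ^ 2) / 2)) = fun t => Real.exp ((-(1 / 2)) * t ^ 2) := by
    funext s; congr 1; ring
  rw [e]
  refine h.exp.congr_deriv ?_
  push_cast; ring

/-- **`r' = r₁`**: the derivative of `r(t) = (λ + iU(t))⁻¹` is `-(i e^{-t²/2}) / (λ+iU)²`. [folklore] -/
theorem hasDerivAt_kerR {lam : ℂ} (hlam : 0 < lam.re) (t : ℝ) :
    HasDerivAt (fun t => (lam + I * U t)⁻¹)
      (-(I * (Real.exp (-(t ^ 2) / 2) : ℂ)) / (lam + I * U t) ^ 2) t := by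
  have hc : HasDerivAt (fun t => lam + I * (U t : ℂ)) (I * (Real.exp (-(t ^ 2) / 2) : ℂ)) t := by
    have := ((hasDerivAt_U t).ofReal_comp).const_mul I
    simpa using this.const_add lam
  exact hc.inv (lam_add_ne_zero hlam t)

/-- **`r₁' = r₂`** with `r₂ = i t e^{-t²/2}/(λ+iU)² - 2 e^{-t²}/(λ+iU)³`. [folklore] -/
theorem hasDerivAt_kerR₁ {lam : ℂ} (hlam : 0 < lam.re) (t : ℝ) :
    HasDerivAt (fun t => -(I * (Real.exp (-(t ^ 2) / 2) : ℂ)) / (lam + I * U t) ^ 2)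
      (I * (t : ℂ) * (Real.exp (-(t ^ 2) / 2) : ℂ) / (lam + I * U t) ^ 2 -
        2 * (Real.exp (-(t ^ 2) / 2) : ℂ) ^ 2 / (lam + I * U t) ^ 3) t := by
  have hne := lam_add_ne_zero hlam t
  -- numerator
  have hN : HasDerivAt (fun t : ℝ => -(I * (Real.exp (-(t ^ 2) / 2) : ℂ)))
      (I * (t : ℂ) * (Real.exp (-(t ^ 2) / 2) : ℂ)) t := by
    have h1 : HasDerivAt (fun t : ℝ => Real.exp (-(t ^ 2) / 2)) (Real.exp (-(t ^ 2) / 2) * (-t)) t :=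
      hasDerivAt_gauss t
    have h2 := (h1.ofReal_comp.const_mul I).const_mul (-1)
    have e : (fun t : ℝ => -(I * (Real.exp (-(t ^ 2) / 2) : ℂ))) = fun t : ℝ => -1 * (I * (Real.exp (-(t ^ 2) / 2) : ℂ)) := by
      funext s; ring
    rw [e]
    refine h2.congr_deriv ?_
    push_cast; ring
  -- r² via the inverse
  have hr := hasDerivAt_kerR hlam t
  have hr2 : HasDerivAt (fun t => ((lam + I * U t)⁻¹) ^ 2)
      (2 * (lam + I * U t)⁻¹ * (-(I * (Real.exp (-(t ^ 2) / 2) : ℂ)) / (lam + I * U t) ^ 2)) t := by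
    refine (hr.pow 2).congr_deriv ?_
    push_cast; ring
  have hprod := hN.mul hr2
  have hfun : (fun t => -(I * (Real.exp (-(t ^ 2) / 2) : ℂ)) / (lam + I * U t) ^ 2) =
      fun t => -(I * (Real.exp (-(t ^ 2) / 2) : ℂ)) * ((lam + I * U t)⁻¹) ^ 2 := by
    funext s; rw [div_eq_mul_inv, inv_pow]
  rw [hfun]
  refine hprod.congr_deriv ?_
  field_simp
  linear_combination (2 * (Real.exp (-(t ^ 2 / 2)) : ℂ)) * Complex.I_sq

/-- Kernel bounds: `‖(λ+iU)⁻¹‖ ≤ 1/ℓ`, `‖r₁‖ ≤ 1/ℓ²`, `‖r₂‖ ≤ 1/ℓ² + 2/ℓ³` when `re λ ≥ ℓ > 0`.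
[folklore] -/
theorem kerR_bounds {lam : ℂ} {ℓ : ℝ} (hℓ : 0 < ℓ) (hlam : ℓ ≤ lam.re) (t : ℝ) :
    ‖(lam + I * U t)⁻¹‖ ≤ 1 / ℓ ∧
    ‖-(I * (Real.exp (-(t ^ 2) / 2) : ℂ)) / (lam + I * U t) ^ 2‖ ≤ 1 / ℓ ^ 2 ∧
    ‖I * (t : ℂ) * (Real.exp (-(t ^ 2) / 2) : ℂ) / (lam + I * U t) ^ 2 -
        2 * (Real.exp (-(t ^ 2) / 2) : ℂ) ^ 2 / (lam + I * U t) ^ 3‖ ≤ 1 / ℓ ^ 2 + 2 / ℓ ^ 3 := by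
  have hc : ℓ ≤ ‖lam + I * U t‖ := hlam.trans (re_le_norm_lam_add lam t)
  have hcpos : 0 < ‖lam + I * U t‖ := hℓ.trans_le hc
  have he1 : ‖(Real.exp (-(t ^ 2) / 2) : ℂ)‖ ≤ 1 := by
    rw [Complex.norm_real, Real.norm_of_nonneg (Real.exp_pos _).le, Real.exp_le_one_iff]
    nlinarith [sq_nonneg t]
  have he0 : 0 ≤ ‖(Real.exp (-(t ^ 2) / 2) : ℂ)‖ := norm_nonneg _
  have hte : ‖(t : ℂ) * (Real.exp (-(t ^ 2) / 2) : ℂ)‖ ≤ 1 := by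
    rw [norm_mul, Complex.norm_real, Complex.norm_real, Real.norm_eq_abs,
      Real.norm_of_nonneg (Real.exp_pos _).le]
    -- |t| e^{-t²/2} ≤ 1 since |t| ≤ 1 + t²/2 ≤ e^{t²/2}
    have h1 : |t| ≤ Real.exp (t ^ 2 / 2) := by
      have := Real.add_one_le_exp (t ^ 2 / 2)
      nlinarith [sq_abs t, abs_nonneg t, sq_nonneg (|t| - 1)]
    have h2 : Real.exp (t ^ 2 / 2) * Real.exp (-(t ^ 2) / 2) = 1 := by
      rw [← Real.exp_add]; simp [show t ^ 2 / 2 + -(t ^ 2) / 2 = 0 by ring]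
    calc |t| * Real.exp (-(t ^ 2) / 2) ≤ Real.exp (t ^ 2 / 2) * Real.exp (-(t ^ 2) / 2) := by
          gcongr
      _ = 1 := h2
  have hb1 : ‖(lam + I * U t)⁻¹‖ ≤ 1 / ℓ := by
    rw [norm_inv, ← one_div]; exact one_div_le_one_div_of_le hℓ hc
  have hb2 : ‖-(I * (Real.exp (-(t ^ 2) / 2) : ℂ)) / (lam + I * U t) ^ 2‖ ≤ 1 / ℓ ^ 2 := by
    rw [norm_div, norm_neg, norm_mul, Complex.norm_I, one_mul, norm_pow]
    gcongr
  have hb3 : ‖I * (t : ℂ) * (Real.exp (-(t ^ 2) / 2) : ℂ) / (lam + I * U t) ^ 2‖ ≤ 1 / ℓ ^ 2 := by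
    rw [norm_div, mul_assoc, norm_mul, Complex.norm_I, one_mul, norm_pow]
    gcongr
  have hb4 : ‖2 * (Real.exp (-(t ^ 2) / 2) : ℂ) ^ 2 / (lam + I * U t) ^ 3‖ ≤ 2 / ℓ ^ 3 := by
    rw [norm_div, norm_mul, norm_pow, norm_pow, Complex.norm_ofNat]
    calc 2 * ‖(Real.exp (-(t ^ 2) / 2) : ℂ)‖ ^ 2 / ‖lam + I * U t‖ ^ 3 ≤ 2 * 1 ^ 2 / ℓ ^ 3 := by
          gcongr
      _ = 2 / ℓ ^ 3 := by ring
  refine ⟨hb1, hb2, ?_⟩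
  calc ‖I * (t : ℂ) * (Real.exp (-(t ^ 2) / 2) : ℂ) / (lam + I * U t) ^ 2 -
        2 * (Real.exp (-(t ^ 2) / 2) : ℂ) ^ 2 / (lam + I * U t) ^ 3‖
      ≤ ‖I * (t : ℂ) * (Real.exp (-(t ^ 2) / 2) : ℂ) / (lam + I * U t) ^ 2‖ +
        ‖2 * (Real.exp (-(t ^ 2) / 2) : ℂ) ^ 2 / (lam + I * U t) ^ 3‖ := norm_sub_le _ _
    _ ≤ 1 / ℓ ^ 2 + 2 / ℓ ^ 3 := add_le_add hb3 hb4

/-- **Set-integral version of the `peg` bound on a right half-line**, for functions bounded only on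
`t ≥ y`. [folklore] -/
theorem peg_setIntegral_bound (n : ℕ) (a : ℝ) : ∃ C : ℝ, 0 < C ∧ ∀ f : ℝ → ℂ, Continuous f → ∀ M y : ℝ, (∀ t, y ≤ t → ‖f t‖ ≤ M * ((1 + |t|) ^ n * Real.exp (a * t) * Real.exp (-(t ^ 2) / 4))) → IntegrableOn f (Ioi y) ∧ ‖∫ t in Ioi y, f t‖ ≤ |M| * C := by
  obtain ⟨C₁, hC₁, hCb⟩ := poly_exp_gauss_le n a
  set K : ℝ := ∫ t : ℝ, Real.exp (-(t ^ 2) / 8) with hK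
  have hKpos : 0 < K := integral_exp_neg_sq_div_eight_pos
  refine ⟨C₁ * K, by positivity, fun f hf M y hb => ?_⟩
  set g : ℝ → ℝ := fun t => |M| * C₁ * Real.exp (-(t ^ 2) / 8) with hg
  have hgint : Integrable g := integrable_exp_neg_sq_div_eight.const_mul _
  have hbound : ∀ t, y ≤ t → ‖f t‖ ≤ g t := by
    intro t ht
    calc ‖f t‖ ≤ M * ((1 + |t|) ^ n * Real.exp (a * t) * Real.exp (-(t ^ 2) / 4)) := hb t ht
      _ ≤ |M| * ((1 + |t|) ^ n * Real.exp (a * t) * Real.exp (-(t ^ 2) / 4)) :=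
          mul_le_mul_of_nonneg_right (le_abs_self M) (by positivity)
      _ ≤ |M| * (C₁ * Real.exp (-(t ^ 2) / 8)) := mul_le_mul_of_nonneg_left (hCb t) (abs_nonneg M)
      _ = g t := by simp only [hg]; ring
  have hae : ∀ᵐ t ∂(volume.restrict (Ioi y)), ‖f t‖ ≤ g t :=
    ae_restrict_of_forall_mem measurableSet_Ioi fun t ht => hbound t (le_of_lt ht)
  have hint : IntegrableOn f (Ioi y) :=
    Integrable.mono' hgint.integrableOn hf.aestronglyMeasurable.restrict hae
  refine ⟨hint, ?_⟩
  have hg0 : 0 ≤ᵐ[volume] g := Filter.Eventually.of_forall fun t => by simp only [hg, Pi.zero_apply]; positivity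
  calc ‖∫ t in Ioi y, f t‖ ≤ ∫ t in Ioi y, ‖f t‖ := norm_integral_le_integral_norm _
    _ ≤ ∫ t in Ioi y, g t := integral_mono_ae hint.norm hgint.integrableOn hae
    _ ≤ ∫ t, g t := setIntegral_le_integral hgint hg0
    _ = |M| * (C₁ * K) := by simp only [hg]; rw [MeasureTheory.integral_const_mul, hK]; ring

/-- `e^{αy} e^{-y²/4} ≤ e^{α²}`. [folklore] -/
theorem exp_lin_gauss_le (α y : ℝ) : Real.exp (α * y) * Real.exp (-(y ^ 2) / 4) ≤ Real.exp (α ^ 2) := by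
  rw [← Real.exp_add, Real.exp_le_exp]
  nlinarith [sq_nonneg (y - 2 * α)]

end Summit.AnomalousDissipation.AnomalousDissipation.Theorems.BurgersLayerKH.Sheet.Strained

end
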